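import Literature.AlgebraicGeometry.HodgeTheory.MaxRationalSubHodgeStructureHodgeClasses
import Literature.Barriers.HodgeConjecture.GeneralizedHodgeTrivialReasonsHolds
import HarnessLib

/-!
# Grothendieck's inclusion (∗) in amended form: `Nᵖ Hⁱ(X(ℂ); ℂ)` is an admissible subspace, hence
# `Nᵖ Hⁱ ≤ max(i, p)`, and `GHC(X, i, p)` is the EQUALITY `max(i, p) = Nᵖ Hⁱ`

Family `hodge`, layer `Literature/AlgebraicGeometry/HodgeTheory`; lane `lit-hodgefound` (Track 2 foundations,
Layer A1/A4). THEOREMS ONLY (no definition, no named fact; D-0026).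

Grothendieck, Topology 8 (1969): p. 299 formula (∗) `Filt'ᵖ Hⁱ(X^an, ℚ) ⊆ Filtᵖ Hⁱ(X^an, ℂ) ∩ Hⁱ(X^an, ℚ)`
(`Filt'` the arithmetic = coniveau filtration); p. 300: the right-hand side should be replaced by «the largest
sub-space of the right hand side, generating a subspace of `Hⁱ(X^an, ℂ)` which is a sub-Hodge structure»,
and footnote †: «`Filt'ᵖ` can be also described as the space generated by the images of the Gysin
homomorphisms … As the previous homomorphisms are compatible with the Hodge structures, the assertion
follows» — i.e. `Filt'ᵖ Hⁱ ⊗ ℂ` is itself a rational sub-Hodge structure contained in `Fᵖ`, so (∗) survives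
the amendment: `Filt'ᵖ Hⁱ ⊗ ℂ ⊆ max(i, p)`. The module docstring of `GeneralHodgePropertyCMType` records this
inclusion as «KNOWN (Grothendieck p. 299 (∗) with p. 300; Deligne's mixed Hodge theory, Voisin I p. 290) and
not part of the definition». The tree now PROVES its inputs: `Nᵖ Hⁱ(X(ℂ); ℂ) = supportedClasses X i p` is
the complex span of its rational classes (`supportedClasses_eq_span_isRationalClass`, universal
coefficients), that span pulls back to a sub-Hodge structure in every Hodge model
(`Literature.Barriers.HodgeConjecture.Grothendieck1969_supportedClasses_isSubHodge_holds`, from Deligne,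
Hodge III, Prop. 8.2.7 / Cor. 8.2.8 proved in the tree, Hironaka and the bidegree of the Gysin morphisms)
and lies in `Fᵖ` (`…Grothendieck1969_supportedClasses_le_hodgeFiltration_holds`). Hence, on the carriers:

* §1 **`HodgeModel.supportedClasses_mem_ratSubHodgeInFilt`** (`Nᵖ Hⁱ` is admissible:
  `isRationallySpanned_supportedClasses`, `HodgeModel.isSubHodge_map_supportedClasses`,
  `HodgeModel.supportedClasses_le_hodgeFiltrationBetti`) and **`HodgeModel.supportedClasses_le_maxRatSubHodgeInFilt`**
  — Grothendieck's (∗) in amended form, `Nᵖ Hⁱ(X(ℂ); ℂ) ≤ max(i, p)`, unconditionally.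
* §2 **`generalHodgePropertyFor_iff_maxRatSubHodgeInFilt_eq`** — `GHC(X, i, p) ↔ max(i, p) = Nᵖ Hⁱ`
  (Grothendieck's «should be», as an equality); **`generalHodgePropertyFor_iff_isGreatest`** (`↔ Nᵖ Hⁱ` is
  the GREATEST admissible subspace); `not_generalHodgePropertyFor_iff_lt` (failure = a strict inclusion
  `Nᵖ Hⁱ < max(i, p)`); `generalHodgePropertyFor_iff_finrank_le` (`↔ dim max(i, p) ≤ dim Nᵖ Hⁱ`: a
  comparison of two integers).
* §3 LEVEL: `HodgeModel.map_le_hodgeConiveau_of_mem_ratSubHodgeInFilt` and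
  **`HodgeModel.map_maxRatSubHodgeInFilt_le_hodgeConiveau`** — every admissible subspace of `(Hⁱ, Fʳ)`, in
  particular `max(i, r)`, has Hodge coniveau `≥ r` (its pull-back lies in `⊕_{p, q ≥ r} H^{p,q}`: rational
  classes in `Fʳ` do, `IsRationalClass.pullback_mem_hodgeConiveau_of_mem_hodgeFiltrationBetti`); so «`L ⊂ Fᵏ`»
  in Voisin's Conj. 11.37 is «level `≤ i − 2k`» (Voisin 2025 Def. 2.4, Conj. 4.7's «Hodge coniveau `c`»).
* §4 DEGREE `2p`: **`hodgeConjectureFor_iff_forall_span_hodgeClasses_eq_algebraicClasses`** — `HC(X) ↔` for all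
  `p`, `span_ℂ {rational (p, p)-classes} = Nᵖ H²ᵖ(X(ℂ); ℂ) = algebraicClasses X p` (with
  `maxRatSubHodgeInFilt_two_mul_self_eq_span`; the inclusion `⊇` alone is the tree's
  `algebraicClasses_le_span_hodgeClasses`, Voisin I Prop. 11.20, not restated), and
  `generalHodgePropertyFor_two_mul_self_iff_span_eq`.

## References

* [GrothendieckTopology1969] A. Grothendieck, Hodge's general conjecture is false for trivial reasons,
  Topology 8 (1969), p. 299 formula (∗), p. 300 (amended statement and footnote †), p. 301.
* [DeligneHodgeIII1974] P. Deligne, Théorie de Hodge III, Publ. Math. IHÉS 44 (1974), Prop. 8.2.7, Cor. 8.2.8.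
* [VoisinHodgeI2002] C. Voisin, Hodge Theory and Complex Algebraic Geometry I, CUP 2002, §7.1.1, §7.3.1–7.3.2,
  §11.1.2 Prop. 11.20, §11.3 Conj. 11.37 (and p. 290).
* [Voisin2025] C. Voisin, Hodge and generalized Hodge conjectures, coniveau and algebraic cycles, J. Open
  Math. Probl. 1 (2025), Def. 2.4, §4.1 Cor. 4.5 (ii) («the set of degree `k` cohomology classes of geometric
  coniveau `≥ c` is a Hodge substructure of `Hᵏ(X, ℚ)` of Hodge coniveau `≥ c`»), Conj. 4.7, Prop. 4.8.
-/

noncomputable section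

open CategoryTheory AlgebraicGeometry Module
open Literature.AlgebraicTopology.SingularHomology
open Literature.Geometry.Kaehler
open Literature.AlgebraicGeometry.Motives (IsSmoothProjective ComplexPoints)
open Literature.Barriers.HodgeConjecture (Grothendieck1969_supportedClasses_isSubHodge_holds
  Grothendieck1969_supportedClasses_le_hodgeFiltration_holds)

namespace Literature.AlgebraicGeometry.HodgeTheory

variable {n : ℕ} {X : Motives.SchemeOver ℂ}

/-! ### §1 `Nᵖ Hⁱ(X(ℂ); ℂ)` is an admissible subspace; `Nᵖ Hⁱ ≤ max(i, p)` -/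

/-- **`Nᵖ Hⁱ(X(ℂ); ℂ)` is rationally spanned** (`= Filt'ᵖ Hⁱ(X^an, ℚ) ⊗ ℂ`): the tree's
`supportedClasses_eq_span_isRationalClass` in the spelling `IsRationallySpanned`.
[cite: GrothendieckTopology1969, pp. 299–300] -/
theorem isRationallySpanned_supportedClasses (hX : IsSmoothProjective n X) (i p : ℕ) :
    IsRationallySpanned (supportedClasses X i p) := by
  refine (isRationallySpanned_iff_le _).2
    ((supportedClasses_le_span_isRationalClass hX i p).trans (Submodule.span_mono ?_))
  rintro c ⟨hc, hcN⟩
  exact ⟨hcN, hc⟩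

/-- **`Nᵖ Hⁱ(X(ℂ); ℂ)` pulls back to a sub-Hodge structure in every Hodge model** («As the previous
homomorphisms are compatible with the Hodge structures, the assertion follows»): the tree's PROVED
`Grothendieck1969_supportedClasses_isSubHodge_holds` (Deligne, Hodge III, Cor. 8.2.8), read on
`Nᵖ Hⁱ = span of its rational classes`. [cite: GrothendieckTopology1969, p. 300 and footnote †]
[cite: DeligneHodgeIII1974, Cor. 8.2.8] [cite: Voisin2025, §4.1 Cor. 4.5 (ii)] -/
theorem HodgeModel.isSubHodge_map_supportedClasses (A : HodgeModel n X) (hX : IsSmoothProjective n X)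
    (i p : ℕ) : A.IsSubHodge i ((supportedClasses X i p).map (A.pullback i).hom) := by
  rw [supportedClasses_eq_span_isRationalClass hX i p]
  exact Grothendieck1969_supportedClasses_isSubHodge_holds n X hX A i p

/-- **Grothendieck's (∗): `Nᵖ Hⁱ(X(ℂ); ℂ) ⊆ Fᵖ Hⁱ`** in every Hodge model (the tree's PROVED
`Grothendieck1969_supportedClasses_le_hodgeFiltration_holds`, in the spelling `hodgeFiltrationBetti`).
[cite: GrothendieckTopology1969, p. 299 (∗)] -/
theorem HodgeModel.supportedClasses_le_hodgeFiltrationBetti (A : HodgeModel n X)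
    (hX : IsSmoothProjective n X) (i p : ℕ) : supportedClasses X i p ≤ A.hodgeFiltrationBetti i p :=
  fun c hc ↦ A.mem_hodgeFiltrationBetti.2
    (Grothendieck1969_supportedClasses_le_hodgeFiltration_holds n X hX A i p c hc)

/-- **`Nᵖ Hⁱ(X(ℂ); ℂ)` IS AN ADMISSIBLE SUBSPACE of `(Hⁱ, Fᵖ)`**: rationally spanned, a sub-Hodge structure
after pull-back, inside `Fᵖ` — a member of `A.ratSubHodgeInFilt i p` for every Hodge model `A`.
[cite: GrothendieckTopology1969, pp. 299–300 with footnote †] [cite: DeligneHodgeIII1974, Cor. 8.2.8]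
[cite: Voisin2025, §4.1 Cor. 4.5 (ii)] -/
theorem HodgeModel.supportedClasses_mem_ratSubHodgeInFilt (A : HodgeModel n X)
    (hX : IsSmoothProjective n X) (i p : ℕ) : supportedClasses X i p ∈ A.ratSubHodgeInFilt i p :=
  ⟨isRationallySpanned_supportedClasses hX i p, A.isSubHodge_map_supportedClasses hX i p,
    A.supportedClasses_le_hodgeFiltrationBetti hX i p⟩

/-- **GROTHENDIECK'S (∗) IN AMENDED FORM: `Nᵖ Hⁱ(X(ℂ); ℂ) ≤ max(i, p)`** — the classes supported in
codimension `≥ p` lie in the largest rational sub-Hodge structure of `Hⁱ(X(ℂ); ℂ)` contained in `Fᵖ`,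
unconditionally, for every smooth projective complex `X` and every Hodge model. (The reverse inclusion
is `GHC(X, i, p)`.) [cite: GrothendieckTopology1969, p. 299 (∗) and p. 300 with footnote †]
[cite: DeligneHodgeIII1974, Cor. 8.2.8] [cite: VoisinHodgeI2002, §11.3 (p. 290)] -/
theorem HodgeModel.supportedClasses_le_maxRatSubHodgeInFilt (A : HodgeModel n X)
    (hX : IsSmoothProjective n X) (i p : ℕ) : supportedClasses X i p ≤ A.maxRatSubHodgeInFilt i p :=
  A.le_maxRatSubHodgeInFilt (A.supportedClasses_mem_ratSubHodgeInFilt hX i p)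

/-! ### §2 `GHC(X, i, p)` is the equality `max(i, p) = Nᵖ Hⁱ` -/

/-- **`GHC(X, i, p) ↔ max(i, p) = Nᵖ Hⁱ(X(ℂ); ℂ)`**: Grothendieck's amended general Hodge conjecture at
`(X, i, p)` says that the coniveau-`p` classes ARE the largest rational sub-Hodge structure in `Fᵖ Hⁱ`
(«the left hand side of (∗) should be the largest sub-space …»; `≥` is §1, `≤` is the conjecture).
[cite: GrothendieckTopology1969, p. 300] [cite: VoisinHodgeI2002, §11.3 Conj. 11.37] -/
theorem generalHodgePropertyFor_iff_maxRatSubHodgeInFilt_eq (A : HodgeModel n X)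
    (hX : IsSmoothProjective n X) (i p : ℕ) :
    GeneralHodgePropertyFor n X i p ↔ A.maxRatSubHodgeInFilt i p = supportedClasses X i p := by
  rw [generalHodgePropertyFor_iff_of_hodgeModel A hX]
  exact ⟨fun h ↦ le_antisymm h (A.supportedClasses_le_maxRatSubHodgeInFilt hX i p), fun h ↦ h.le⟩

/-- **`GHC(X, i, p) ↔ Nᵖ Hⁱ(X(ℂ); ℂ)` is the GREATEST admissible subspace of `(Hⁱ, Fᵖ)`** (it is one by §1;
`GHC` says every admissible subspace lies in it). [cite: GrothendieckTopology1969, p. 300]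
[cite: VoisinHodgeI2002, §11.3 Conj. 11.37] -/
theorem generalHodgePropertyFor_iff_isGreatest (A : HodgeModel n X) (hX : IsSmoothProjective n X)
    (i p : ℕ) :
    GeneralHodgePropertyFor n X i p ↔ IsGreatest (A.ratSubHodgeInFilt i p) (supportedClasses X i p) := by
  rw [generalHodgePropertyFor_iff_of_hodgeModel A hX]
  exact ⟨fun h ↦ ⟨A.supportedClasses_mem_ratSubHodgeInFilt hX i p,
      fun W hW ↦ (A.le_maxRatSubHodgeInFilt hW).trans h⟩,
    fun h ↦ sSup_le fun W hW ↦ h.2 hW⟩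

/-- **Failure of `GHC(X, i, p)` is a STRICT inclusion `Nᵖ Hⁱ < max(i, p)`**: a rational sub-Hodge structure
in `Fᵖ Hⁱ` not supported in codimension `p` (the shape of every potential counterexample to the amended
conjecture). [cite: GrothendieckTopology1969, p. 300] [cite: Voisin2025, Conj. 4.7 and Prop. 4.8] -/
theorem not_generalHodgePropertyFor_iff_lt (A : HodgeModel n X) (hX : IsSmoothProjective n X)
    (i p : ℕ) :
    ¬ GeneralHodgePropertyFor n X i p ↔ supportedClasses X i p < A.maxRatSubHodgeInFilt i p :=
  (generalHodgePropertyFor_iff_maxRatSubHodgeInFilt_eq A hX i p).not.trans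
    ⟨fun h ↦ lt_of_le_of_ne (A.supportedClasses_le_maxRatSubHodgeInFilt hX i p) (Ne.symm h),
      fun h ↦ h.ne'⟩

/-- **`GHC(X, i, p) ↔ dim_ℂ max(i, p) ≤ dim_ℂ Nᵖ Hⁱ(X(ℂ); ℂ)`** — given §1, the amended conjecture at
`(X, i, p)` is the comparison of two natural numbers (`Hⁱ(X(ℂ); ℂ)` is finite-dimensional,
`finite_complexBetti`). [cite: GrothendieckTopology1969, p. 300] -/
theorem generalHodgePropertyFor_iff_finrank_le (A : HodgeModel n X) (hX : IsSmoothProjective n X)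
    (i p : ℕ) :
    GeneralHodgePropertyFor n X i p ↔
      finrank ℂ (A.maxRatSubHodgeInFilt i p) ≤ finrank ℂ (supportedClasses X i p) := by
  haveI := finite_complexBetti hX i
  rw [generalHodgePropertyFor_iff_maxRatSubHodgeInFilt_eq A hX]
  exact ⟨fun h ↦ h ▸ le_rfl,
    fun h ↦ (Submodule.eq_of_le_of_finrank_le (A.supportedClasses_le_maxRatSubHodgeInFilt hX i p) h).symm⟩

/-! ### §3 Admissible subspaces of `(Hⁱ, Fʳ)` have Hodge coniveau `≥ r` -/

/-- **Every admissible subspace of `(Hⁱ, Fʳ)` has Hodge coniveau `≥ r`**: its pull-back to the Hodge model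
lies in `⊕_{p, q ≥ r} H^{p,q}` (it is spanned by rational classes of `Fʳ Hⁱ`, and these have Hodge
coniveau `≥ r`, `IsRationalClass.pullback_mem_hodgeConiveau_of_mem_hodgeFiltrationBetti`). So «`L ⊂ Fᵏ H^{2k+l}`»
for a rational sub-Hodge structure `L` (Voisin I Conj. 11.37) means «`L` has Hodge coniveau `k`», level `≤ l`.
[cite: VoisinHodgeI2002, §11.3 Conj. 11.37 and §7.1.1] [cite: Voisin2025, Def. 2.4 and Conj. 4.7]
[cite: GrothendieckTopology1969, p. 300] -/
theorem HodgeModel.map_le_hodgeConiveau_of_mem_ratSubHodgeInFilt (A : HodgeModel n X)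
    (hX : IsSmoothProjective n X) {i r : ℕ} {W : Submodule ℂ (complexBetti X i)}
    (hW : W ∈ A.ratSubHodgeInFilt i r) : W.map (A.pullback i).hom ≤ A.hodgeConiveau i r := by
  rw [Submodule.map_le_iff_le_comap]
  refine ((isRationallySpanned_iff_le _).1 hW.1).trans (Submodule.span_le.2 ?_)
  rintro c ⟨hcW, hc⟩
  exact hc.pullback_mem_hodgeConiveau_of_mem_hodgeFiltrationBetti hX A (hW.2.2 hcW)

/-- **`max(i, r)` has Hodge coniveau `≥ r`**: Grothendieck's largest rational sub-Hodge structure in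
`Fʳ Hⁱ(X(ℂ); ℂ)` pulls back into `⊕_{p, q ≥ r} H^{p,q}`. [cite: GrothendieckTopology1969, p. 300]
[cite: Voisin2025, Def. 2.4 and Conj. 4.7] -/
theorem HodgeModel.map_maxRatSubHodgeInFilt_le_hodgeConiveau (A : HodgeModel n X)
    (hX : IsSmoothProjective n X) (i r : ℕ) :
    (A.maxRatSubHodgeInFilt i r).map (A.pullback i).hom ≤ A.hodgeConiveau i r :=
  A.map_le_hodgeConiveau_of_mem_ratSubHodgeInFilt hX (A.maxRatSubHodgeInFilt_mem i r)

/-! ### §4 Degree `2p`: `HC(X) ↔ span of Hodge classes = algebraic classes` -/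

/-- **`GHC(X, 2p, p) ↔ span_ℂ {rational (p, p)-classes} = Nᵖ H²ᵖ(X(ℂ); ℂ)`** (`max(2p, p)` is that span,
`HodgeModel.maxRatSubHodgeInFilt_two_mul_self_eq_span`; `⊇` holds unconditionally — §1, equivalently the
tree's `algebraicClasses_le_span_hodgeClasses`). [cite: GrothendieckTopology1969, pp. 300–301]
[cite: VoisinHodgeI2002, §11.1.2 Prop. 11.20 and §11.3] -/
theorem generalHodgePropertyFor_two_mul_self_iff_span_eq (hX : IsSmoothProjective n X) (p : ℕ) :
    GeneralHodgePropertyFor n X (2 * p) p ↔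
      Submodule.span ℂ {c : complexBetti X (2 * p) | IsRationalClass c ∧ IsOfHodgeType n X (2 * p) p p c} =
        algebraicClasses X p := by
  obtain ⟨A⟩ := nonempty_hodgeModel_holds (n := n) (X := X) hX
  rw [generalHodgePropertyFor_iff_maxRatSubHodgeInFilt_eq A hX, A.maxRatSubHodgeInFilt_two_mul_self_eq_span hX]

/-- **THE HODGE CONJECTURE FOR `X` ⟺ FOR EVERY `p` THE SPAN OF THE RATIONAL `(p, p)`-CLASSES EQUALS
`Nᵖ H²ᵖ(X(ℂ); ℂ) = algebraicClasses X p`** (on the tree's carriers; `⊇` is unconditional).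
[cite: GrothendieckTopology1969, p. 301] [cite: VoisinHodgeI2002, §11.3 and Prop. 11.20]
[cite: Voisin2025, §4.2 with Prop. 4.8] -/
theorem hodgeConjectureFor_iff_forall_span_hodgeClasses_eq_algebraicClasses (hX : IsSmoothProjective n X) :
    HodgeConjectureFor n X ↔ ∀ p : ℕ,
      Submodule.span ℂ {c : complexBetti X (2 * p) | IsRationalClass c ∧ IsOfHodgeType n X (2 * p) p p c} =
        algebraicClasses X p := by
  rw [hodgeConjectureFor_iff_forall_generalHodgePropertyFor hX]
  exact forall_congr' fun p ↦ generalHodgePropertyFor_two_mul_self_iff_span_eq hX p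

end Literature.AlgebraicGeometry.HodgeTheory

end
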